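import Summits.FinalStateConjecture.FinalStateConjecture.Theses.RobustClausewiseGenericity
import Summits.FinalStateConjecture.FinalStateConjecture.Theorems.RobustClausewiseGenericityAssembly
import HarnessLib

/-!
# Crux `CensorshipRobust` (stmt-FinalStateConjecture-10131) · line `walls-and-superposition` (crux-strategist, 2026-08-17)

REGISTERED SKELETON of the typed decomposition `CensorshipWalls ∧ TameAxisSuperposition → CensorshipRobust`
(BC2 redirect of the RESTATED deciding crux of route `RobustClausewiseGenericity`; strategist workfile
`Cruxes/CensorshipRobust/StrategySplit.lean`, `censorshipRobust_of_subs`). FOUR registered stubs — two per piece, of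
four different natures — and the kernel-checked composition `CensorshipRobust_of`, which is the conjunction of three
real proofs: `censorshipWalls_of_stubs` (case split censored / naked), `tameAxisSuperposition_of_stubs` (plateau squash of
a projected cross interpolant) and `robustlyEscapable_of_dataWalls` (transversal enrichment by induction on the walls +
general position).

* `stub_censoredIsProbeOpen` — STABILITY OF CENSORSHIP along compactly supported probes at censored data (large-data
  exterior stability regime; dispersive data by Christodoulou–Klainerman).
* `stub_nakedThresholdWalls` — THRESHOLD WALLS at naked-singularity data: finitely many probe-differentiable, crossable
  functionals whose level sets through `d` capture the non-censored data near the base point of every tame probe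
  (Christodoulou 1999 Thm 4.1 / Angelopoulos–Kehle–Unger 2026 Thm 2 shape; critical-collapse heuristic).
* `stub_crossInterpolant` — CROSS INTERPOLANT (differential topology, double cut-off; provable now).
* `stub_crossProjection` — CONSTRAINT PROJECTION WITH PARAMETERS (Corvino–Schoen 2006 / Chruściel–Delay 2003; KID caveat).

Line card: `Lines/walls-and-superposition.md`. No `def`s; sorries only inside `stub_*`.
-/

noncomputable section

namespace Summit.FinalStateConjecture.FinalStateConjecture.Cruxes.CensorshipRobust.WallsAndSuperposition

open Literature.Geometry.Lorentzian
open Summit.FinalStateConjecture.FinalStateConjecture.Theorems.RobustClausewiseGenericity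
  (Tame RobustlyEscapable dense_setOf_apply_ne_zero)
open Set Function Filter Metric
open scoped Manifold ContDiff Topology

set_option linter.dupNamespace false

/-! ## The four registered stubs -/

/-- **stub_censoredIsProbeOpen** — stability of censorship along compactly supported probes at censored data. -/
theorem stub_censoredIsProbeOpen :
    ∀ (X : Type) [TopologicalSpace X] [ChartedSpace E3 X] [IsManifold (𝓡 3) ∞ X] [T2Space X]
      [SecondCountableTopology X] [ConnectedSpace X], ∀ d ∈ admissibleVacuumData X,
      (∀ 𝒟 : VacuumCauchyDevelopment d, 𝒟.IsMaximal →
        Summit.FinalStateConjecture.HasCompleteNullInfinity 𝒟.toCauchyDevelopment) →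
      ∀ (m : ℕ) (G : EuclideanSpace ℝ (Fin m) → InitialDataSet (𝓡 3) X), Tame d m G →
        ∃ δ : ℝ, 0 < δ ∧ ∀ c, ‖c‖ < δ →
          ∀ 𝒟 : VacuumCauchyDevelopment (G c), 𝒟.IsMaximal →
            Summit.FinalStateConjecture.HasCompleteNullInfinity 𝒟.toCauchyDevelopment := by
  sorry

/-- **stub_nakedThresholdWalls** — threshold walls at naked-singularity data. -/
theorem stub_nakedThresholdWalls :
    ∀ (X : Type) [TopologicalSpace X] [ChartedSpace E3 X] [IsManifold (𝓡 3) ∞ X] [T2Space X]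
      [SecondCountableTopology X] [ConnectedSpace X], ∀ d ∈ admissibleVacuumData X,
      (¬ ∀ 𝒟 : VacuumCauchyDevelopment d, 𝒟.IsMaximal →
        Summit.FinalStateConjecture.HasCompleteNullInfinity 𝒟.toCauchyDevelopment) →
      ∃ (J : ℕ) (Λ : Fin J → InitialDataSet (𝓡 3) X → ℝ),
        (∀ (m : ℕ) (G : EuclideanSpace ℝ (Fin m) → InitialDataSet (𝓡 3) X), Tame d m G →
          ∀ j, DifferentiableAt ℝ (Λ j ∘ G) 0) ∧
        (∀ j, ∃ γ : EuclideanSpace ℝ (Fin 1) → InitialDataSet (𝓡 3) X, Tame d 1 γ ∧ fderiv ℝ (Λ j ∘ γ) 0 ≠ 0) ∧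
        ∀ (m : ℕ) (G : EuclideanSpace ℝ (Fin m) → InitialDataSet (𝓡 3) X), Tame d m G →
          ∃ δ : ℝ, 0 < δ ∧ ∀ c, ‖c‖ < δ → (∀ j, Λ j (G c) ≠ Λ j d) →
            ∀ 𝒟 : VacuumCauchyDevelopment (G c), 𝒟.IsMaximal →
              Summit.FinalStateConjecture.HasCompleteNullInfinity 𝒟.toCauchyDevelopment := by
  sorry

/-- **stub_crossInterpolant** — the cross interpolant (no constraint equations off the cross). -/
theorem stub_crossInterpolant :
    ∀ (X : Type) [TopologicalSpace X] [ChartedSpace E3 X] [IsManifold (𝓡 3) ∞ X] [T2Space X]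
      [SecondCountableTopology X] [ConnectedSpace X], ∀ d ∈ admissibleVacuumData X,
      ∀ (m : ℕ) (G : EuclideanSpace ℝ (Fin m) → InitialDataSet (𝓡 3) X)
        (γ : EuclideanSpace ℝ (Fin 1) → InitialDataSet (𝓡 3) X), Tame d m G → Tame d 1 γ →
        ∃ (P : EuclideanSpace ℝ (Fin (m + 1)) → InitialDataSet (𝓡 3) X)
          (L : EuclideanSpace ℝ (Fin m) →ₗ[ℝ] EuclideanSpace ℝ (Fin (m + 1)))
          (L₁ : EuclideanSpace ℝ (Fin 1) →ₗ[ℝ] EuclideanSpace ℝ (Fin (m + 1)))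
          (π : EuclideanSpace ℝ (Fin (m + 1)) →L[ℝ] ℝ) (ε₀ R : ℝ),
          Function.Injective L ∧ (∀ c, π (L c) = 0) ∧ (∀ s, π (L₁ s) = s 0) ∧ 0 < ε₀ ∧
          InitialDataSet.IsSmoothDataFamily (m + 1) P ∧
          (∃ K : Set X, IsCompact K ∧ ∀ q, ∀ x ∉ K, (P q).h.inner x = d.h.inner x ∧ (P q).k x = d.k x) ∧
          (∀ c, P (L c) = G c) ∧ (∀ s, ‖s‖ < ε₀ → P (L₁ s) = γ s) ∧
          (∀ q, π q = 0 → P q ∈ admissibleVacuumData X) ∧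
          (∀ q, R ≤ ‖q‖ → P q ∈ admissibleVacuumData X) := by
  sorry

/-- **stub_crossProjection** — constraint projection with parameters, keeping admissible members. -/
theorem stub_crossProjection :
    ∀ (X : Type) [TopologicalSpace X] [ChartedSpace E3 X] [IsManifold (𝓡 3) ∞ X] [T2Space X]
      [SecondCountableTopology X] [ConnectedSpace X], ∀ d ∈ admissibleVacuumData X,
      ∀ (N : ℕ) (P : EuclideanSpace ℝ (Fin N) → InitialDataSet (𝓡 3) X) (π : EuclideanSpace ℝ (Fin N) →L[ℝ] ℝ)
        (R : ℝ), InitialDataSet.IsSmoothDataFamily N P →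
        (∃ K : Set X, IsCompact K ∧ ∀ q, ∀ x ∉ K, (P q).h.inner x = d.h.inner x ∧ (P q).k x = d.k x) →
        (∀ q, π q = 0 → P q ∈ admissibleVacuumData X) →
        (∀ q, R ≤ ‖q‖ → P q ∈ admissibleVacuumData X) →
        ∃ (P' : EuclideanSpace ℝ (Fin N) → InitialDataSet (𝓡 3) X) (ε : ℝ), 0 < ε ∧
          InitialDataSet.IsSmoothDataFamily N P' ∧
          (∃ K : Set X, IsCompact K ∧ ∀ q, ∀ x ∉ K, (P' q).h.inner x = d.h.inner x ∧ (P' q).k x = d.k x) ∧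
          (∀ q, P q ∈ admissibleVacuumData X → P' q = P q) ∧
          ∀ q, |π q| < ε → P' q ∈ admissibleVacuumData X := by
  sorry

/-! ## Piece 1 from its stubs: `CensorshipWalls` (verbatim the split child) -/

/-- **`CensorshipWalls` from its two stubs** (case split on whether `d` is censored; `J = 0` at censored data). -/
theorem censorshipWalls_of_stubs :
    (∀ (X : Type) [TopologicalSpace X] [ChartedSpace E3 X] [IsManifold (𝓡 3) ∞ X] [T2Space X]
      [SecondCountableTopology X] [ConnectedSpace X], ∀ d ∈ admissibleVacuumData X,
      (∀ 𝒟 : VacuumCauchyDevelopment d, 𝒟.IsMaximal →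
        Summit.FinalStateConjecture.HasCompleteNullInfinity 𝒟.toCauchyDevelopment) →
      ∀ (m : ℕ) (G : EuclideanSpace ℝ (Fin m) → InitialDataSet (𝓡 3) X), Tame d m G →
        ∃ δ : ℝ, 0 < δ ∧ ∀ c, ‖c‖ < δ →
          ∀ 𝒟 : VacuumCauchyDevelopment (G c), 𝒟.IsMaximal →
            Summit.FinalStateConjecture.HasCompleteNullInfinity 𝒟.toCauchyDevelopment) →
    (∀ (X : Type) [TopologicalSpace X] [ChartedSpace E3 X] [IsManifold (𝓡 3) ∞ X] [T2Space X]
      [SecondCountableTopology X] [ConnectedSpace X], ∀ d ∈ admissibleVacuumData X,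
      (¬ ∀ 𝒟 : VacuumCauchyDevelopment d, 𝒟.IsMaximal →
        Summit.FinalStateConjecture.HasCompleteNullInfinity 𝒟.toCauchyDevelopment) →
      ∃ (J : ℕ) (Λ : Fin J → InitialDataSet (𝓡 3) X → ℝ),
        (∀ (m : ℕ) (G : EuclideanSpace ℝ (Fin m) → InitialDataSet (𝓡 3) X), Tame d m G →
          ∀ j, DifferentiableAt ℝ (Λ j ∘ G) 0) ∧
        (∀ j, ∃ γ : EuclideanSpace ℝ (Fin 1) → InitialDataSet (𝓡 3) X, Tame d 1 γ ∧ fderiv ℝ (Λ j ∘ γ) 0 ≠ 0) ∧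
        ∀ (m : ℕ) (G : EuclideanSpace ℝ (Fin m) → InitialDataSet (𝓡 3) X), Tame d m G →
          ∃ δ : ℝ, 0 < δ ∧ ∀ c, ‖c‖ < δ → (∀ j, Λ j (G c) ≠ Λ j d) →
            ∀ 𝒟 : VacuumCauchyDevelopment (G c), 𝒟.IsMaximal →
              Summit.FinalStateConjecture.HasCompleteNullInfinity 𝒟.toCauchyDevelopment) →
    (∀ (X : Type) [TopologicalSpace X] [ChartedSpace Literature.Geometry.Lorentzian.E3 X] [IsManifold (𝓡 3) ((⊤ : ℕ∞) : WithTop ℕ∞) X] [T2Space X] [SecondCountableTopology X] [ConnectedSpace X], ∀ d ∈ Literature.Geometry.Lorentzian.admissibleVacuumData X, let Tame : (m : ℕ) → (EuclideanSpace ℝ (Fin m) → Literature.Geometry.Lorentzian.InitialDataSet (𝓡 3) X) → Prop := fun m G ↦ Literature.Geometry.Lorentzian.InitialDataSet.IsSmoothDataFamily m G ∧ G 0 = d ∧ (∀ c, G c ∈ Literature.Geometry.Lorentzian.admissibleVacuumData X) ∧ ∃ K : Set X, IsCompact K ∧ ∀ c, ∀ x ∉ K, (G c).h.inner x = d.h.inner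 x ∧ (G c).k x = d.k x; let Q : Literature.Geometry.Lorentzian.InitialDataSet (𝓡 3) X → Prop := fun D ↦ ∀ 𝒟 : Literature.Geometry.Lorentzian.VacuumCauchyDevelopment D, 𝒟.IsMaximal → Summit.FinalStateConjecture.HasCompleteNullInfinity 𝒟.toCauchyDevelopment; ∃ (J : ℕ) (Λ : Fin J → Literature.Geometry.Lorentzian.InitialDataSet (𝓡 3) X → ℝ), (∀ (m : ℕ) (G : EuclideanSpace ℝ (Fin m) → Literature.Geometry.Lorentzian.InitialDataSet (𝓡 3) X), Tame m G → ∀ j, DifferentiableAt ℝ (Λ j ∘ G) 0) ∧ (∀ j, ∃ γ : EuclideanSpace ℝ (Fin 1) → Literature.Geometry.Lorentzian.InitialDataSet (𝓡 3) X, Tame 1 γ ∧ fderiv ℝ (Λ j ∘ γ) 0 ≠ 0) ∧ ∀ (m : ℕ) (G : EuclideanSpace ℝ (Fin m) → Literature.Geometry.Lorentzian.InitialDataSet (𝓡 3) X), Tame m G → ∃ δ : ℝ, 0 < δ ∧ ∀ c, ‖c‖ < δ → (∀ j, Λ j (G c) ≠ Λ j d) → Q (G c)) := by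
  intro hopen hwalls X _ _ _ _ _ _ d hd
  dsimp only
  by_cases hQ : ∀ 𝒟 : VacuumCauchyDevelopment d, 𝒟.IsMaximal →
      Summit.FinalStateConjecture.HasCompleteNullInfinity 𝒟.toCauchyDevelopment
  · -- censored base datum: no wall, (ii) = probe-openness
    refine ⟨0, fun j => j.elim0, fun m G hG j => j.elim0, fun j => j.elim0, fun m G hG => ?_⟩
    obtain ⟨δ, hδ, h⟩ := hopen X d hd hQ m G hG
    exact ⟨δ, hδ, fun c hc _ => h c hc⟩
  · -- naked-singularity base datum: the threshold walls
    exact hwalls X d hd hQ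


/-! ## Piece 2 from its stubs: `TameAxisSuperposition` (verbatim the split child) -/

/-- **`TameAxisSuperposition` from its two stubs** (plateau squash of the projected cross interpolant). -/
theorem tameAxisSuperposition_of_stubs :
    (∀ (X : Type) [TopologicalSpace X] [ChartedSpace E3 X] [IsManifold (𝓡 3) ∞ X] [T2Space X]
      [SecondCountableTopology X] [ConnectedSpace X], ∀ d ∈ admissibleVacuumData X,
      ∀ (m : ℕ) (G : EuclideanSpace ℝ (Fin m) → InitialDataSet (𝓡 3) X)
        (γ : EuclideanSpace ℝ (Fin 1) → InitialDataSet (𝓡 3) X), Tame d m G → Tame d 1 γ →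
        ∃ (P : EuclideanSpace ℝ (Fin (m + 1)) → InitialDataSet (𝓡 3) X)
          (L : EuclideanSpace ℝ (Fin m) →ₗ[ℝ] EuclideanSpace ℝ (Fin (m + 1)))
          (L₁ : EuclideanSpace ℝ (Fin 1) →ₗ[ℝ] EuclideanSpace ℝ (Fin (m + 1)))
          (π : EuclideanSpace ℝ (Fin (m + 1)) →L[ℝ] ℝ) (ε₀ R : ℝ),
          Function.Injective L ∧ (∀ c, π (L c) = 0) ∧ (∀ s, π (L₁ s) = s 0) ∧ 0 < ε₀ ∧
          InitialDataSet.IsSmoothDataFamily (m + 1) P ∧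
          (∃ K : Set X, IsCompact K ∧ ∀ q, ∀ x ∉ K, (P q).h.inner x = d.h.inner x ∧ (P q).k x = d.k x) ∧
          (∀ c, P (L c) = G c) ∧ (∀ s, ‖s‖ < ε₀ → P (L₁ s) = γ s) ∧
          (∀ q, π q = 0 → P q ∈ admissibleVacuumData X) ∧
          (∀ q, R ≤ ‖q‖ → P q ∈ admissibleVacuumData X)) →
    (∀ (X : Type) [TopologicalSpace X] [ChartedSpace E3 X] [IsManifold (𝓡 3) ∞ X] [T2Space X]
      [SecondCountableTopology X] [ConnectedSpace X], ∀ d ∈ admissibleVacuumData X,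
      ∀ (N : ℕ) (P : EuclideanSpace ℝ (Fin N) → InitialDataSet (𝓡 3) X) (π : EuclideanSpace ℝ (Fin N) →L[ℝ] ℝ)
        (R : ℝ), InitialDataSet.IsSmoothDataFamily N P →
        (∃ K : Set X, IsCompact K ∧ ∀ q, ∀ x ∉ K, (P q).h.inner x = d.h.inner x ∧ (P q).k x = d.k x) →
        (∀ q, π q = 0 → P q ∈ admissibleVacuumData X) →
        (∀ q, R ≤ ‖q‖ → P q ∈ admissibleVacuumData X) →
        ∃ (P' : EuclideanSpace ℝ (Fin N) → InitialDataSet (𝓡 3) X) (ε : ℝ), 0 < ε ∧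
          InitialDataSet.IsSmoothDataFamily N P' ∧
          (∃ K : Set X, IsCompact K ∧ ∀ q, ∀ x ∉ K, (P' q).h.inner x = d.h.inner x ∧ (P' q).k x = d.k x) ∧
          (∀ q, P q ∈ admissibleVacuumData X → P' q = P q) ∧
          ∀ q, |π q| < ε → P' q ∈ admissibleVacuumData X) →
    (∀ (X : Type) [TopologicalSpace X] [ChartedSpace Literature.Geometry.Lorentzian.E3 X] [IsManifold (𝓡 3) ((⊤ : ℕ∞) : WithTop ℕ∞) X] [T2Space X] [SecondCountableTopology X] [ConnectedSpace X], ∀ d ∈ Literature.Geometry.Lorentzian.admissibleVacuumData X, let Tame : (m : ℕ) → (EuclideanSpace ℝ (Fin m) → Literature.Geometry.Lorentzian.InitialDataSet (𝓡 3) X) → Prop := fun m G ↦ Literature.Geometry.Lorentzian.InitialDataSet.IsSmoothDataFamily m G ∧ G 0 = d ∧ (∀ c, G c ∈ Literature.Geometry.Lorentzian.admissibleVacuumData X) ∧ ∃ K : Set X, IsCompact K ∧ ∀ c, ∀ x ∉ K, (G c).h.inner x = d.h.inner x ∧ (G c).k x = d.k x; ∀ (m : ℕ) (G : EuclideanSpace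 ℝ (Fin m) → Literature.Geometry.Lorentzian.InitialDataSet (𝓡 3) X) (γ : EuclideanSpace ℝ (Fin 1) → Literature.Geometry.Lorentzian.InitialDataSet (𝓡 3) X), Tame m G → Tame 1 γ → ∃ (n : ℕ) (G₁ : EuclideanSpace ℝ (Fin n) → Literature.Geometry.Lorentzian.InitialDataSet (𝓡 3) X) (L : EuclideanSpace ℝ (Fin m) →ₗ[ℝ] EuclideanSpace ℝ (Fin n)) (L₁ : EuclideanSpace ℝ (Fin 1) →ₗ[ℝ] EuclideanSpace ℝ (Fin n)), Function.Injective L ∧ Tame n G₁ ∧ (∀ c, G₁ (L c) = G c) ∧ ∃ ε : ℝ, 0 < ε ∧ ∀ s, ‖s‖ < ε → G₁ (L₁ s) = γ s) := by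
  intro hI hP X _ _ _ _ _ _ d hd
  dsimp only
  intro m G γ hG hγ
  obtain ⟨P, L, L₁, π, ε₀, R, hL, hπL, hπL₁, hε₀, hPs, hPK, hPG, hPγ, hP0, hPR⟩ := hI X d hd m G γ hG hγ
  obtain ⟨P', ε, hε, hP's, ⟨K', hK', hP'K⟩, hP'P, hP'adm⟩ := hP X d hd (m + 1) P π R hPs hPK hP0 hPR
  -- the plateau squash `σ t = t · b t`
  obtain ⟨ε₁, hε₁pos, hε₁ε, hε₁ε₀⟩ : ∃ ε₁ : ℝ, 0 < ε₁ ∧ 4 * ε₁ ≤ ε ∧ 2 * ε₁ ≤ ε₀ :=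
    ⟨min (ε / 4) (ε₀ / 2), lt_min (by positivity) (by positivity),
      by linarith [min_le_left (ε / 4) (ε₀ / 2)], by linarith [min_le_right (ε / 4) (ε₀ / 2)]⟩
  let b : ContDiffBump (0 : ℝ) := ⟨ε₁, 2 * ε₁, hε₁pos, by linarith⟩
  let σ : ℝ → ℝ := fun t => t * b t
  have hσs : ContDiff ℝ ∞ σ := contDiff_id.mul b.contDiff
  have hσid : ∀ t : ℝ, |t| ≤ ε₁ → σ t = t := fun t ht => by
    show t * b t = t
    rw [b.one_of_mem_closedBall (by rw [Metric.mem_closedBall, Real.dist_eq, sub_zero]; exact ht), mul_one]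
  have hσlt : ∀ t : ℝ, |σ t| < ε := fun t => by
    show |t * b t| < ε
    by_cases ht : 2 * ε₁ ≤ |t|
    · rw [b.zero_of_le_dist (by rw [Real.dist_eq, sub_zero]; exact ht), mul_zero, abs_zero]
      exact hε
    · push Not at ht
      calc |t * b t| = |t| * b t := by rw [abs_mul, abs_of_nonneg b.nonneg]
        _ ≤ |t| * 1 := mul_le_mul_of_nonneg_left b.le_one (abs_nonneg t)
        _ < ε := by linarith
  -- the reparametrisation `Ψ q = q + (σ (π q) - π q) • e`
  let e : EuclideanSpace ℝ (Fin (m + 1)) := L₁ (EuclideanSpace.single 0 1)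
  have hπe : π e = 1 := by
    show π (L₁ (EuclideanSpace.single 0 1)) = 1
    rw [hπL₁]
    simp
  let Ψ : EuclideanSpace ℝ (Fin (m + 1)) → EuclideanSpace ℝ (Fin (m + 1)) :=
    fun q => q + (σ (π q) - π q) • e
  have hΨs : ContDiff ℝ ∞ Ψ :=
    contDiff_id.add (((hσs.comp π.contDiff).sub π.contDiff).smul contDiff_const)
  have hπΨ : ∀ q, π (Ψ q) = σ (π q) := fun q => by
    show π (q + (σ (π q) - π q) • e) = σ (π q)
    rw [map_add, map_smul, hπe, smul_eq_mul, mul_one]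
    ring
  have hΨfix : ∀ q, |π q| ≤ ε₁ → Ψ q = q := fun q hq => by
    show q + (σ (π q) - π q) • e = q
    rw [hσid _ hq, sub_self, zero_smul, add_zero]
  refine ⟨m + 1, fun q => P' (Ψ q), L, L₁, hL,
    ⟨hP's.comp_contDiff hΨs, ?_, fun q => hP'adm _ ?_, K', hK', fun q x hx => hP'K _ x hx⟩,
    fun c => ?_, ε₁, hε₁pos, fun s hs => ?_⟩
  · -- base point: `Ψ 0 = 0`, `P' 0 = P 0 = G 0 = d`
    show P' (Ψ 0) = d
    have hΨ0 : Ψ 0 = 0 := hΨfix 0 (by rw [map_zero, abs_zero]; exact hε₁pos.le)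
    have hPG0 : P 0 = G 0 := by simpa using hPG 0
    rw [hΨ0, hP'P 0 (hP0 0 (map_zero π)), hPG0, hG.2.1]
  · -- admissibility everywhere: `|π (Ψ q)| = |σ (π q)| < ε`
    rw [hπΨ]
    exact hσlt _
  · -- the enrichment survives: `Ψ (L c) = L c`, `P' (L c) = P (L c) = G c`
    show P' (Ψ (L c)) = G c
    rw [hΨfix (L c) (by rw [hπL c, abs_zero]; exact hε₁pos.le), hP'P _ (hP0 _ (hπL c)), hPG]
  · -- the local axis survives: `‖s‖ < ε₁ ⇒ Ψ (L₁ s) = L₁ s`, `P' (L₁ s) = P (L₁ s) = γ s`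
    show P' (Ψ (L₁ s)) = γ s
    have hs0 : |s 0| ≤ ε₁ := by
      have h := PiLp.norm_apply_le s 0
      rw [Real.norm_eq_abs] at h
      exact h.trans hs.le
    have hsε₀ : ‖s‖ < ε₀ := by linarith
    have hPγs : P (L₁ s) = γ s := hPγ s hsε₀
    rw [hΨfix (L₁ s) (by rw [hπL₁]; exact hs0), hP'P _ (by rw [hPγs]; exact hγ.2.2.1 s), hPγs]


/-! ## The glue: data-space walls + superposition ⇒ robust escapability (copied from `StrategySplit.lean`) -/

section DataWalls

variable {X : Type} [TopologicalSpace X] [ChartedSpace E3 X] [IsManifold (𝓡 3) ∞ X]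

/-- **Data-space walls + local axis superposition ⇒ robust escapability** (abstract property `Q`).
Hypotheses: finitely many functionals `Λⱼ` on data, (i) differentiable at the base point along every tame probe
through `d`, (iii) each crossable by a tame curve, (ii) capturing the `Q`-bad data near the base point of every
tame probe inside the union of their level sets through `d`; and the superposition principle at `d` (every tame
probe and tame curve sit in one tame probe with the curve as a local axis). Conclusion: `Q` is robustly escapable
at `d`. Proof: transversal enrichment by induction on the walls, then general position (see the module
docstring). [cite: Christodoulou1999, p. A24] -/
theorem robustlyEscapable_of_dataWalls {d : InitialDataSet (𝓡 3) X} {Q : InitialDataSet (𝓡 3) X → Prop}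
    {J : ℕ} (Λ : Fin J → InitialDataSet (𝓡 3) X → ℝ)
    (hdiff : ∀ (m : ℕ) (G : EuclideanSpace ℝ (Fin m) → InitialDataSet (𝓡 3) X), Tame d m G →
      ∀ j, DifferentiableAt ℝ (Λ j ∘ G) 0)
    (hcross : ∀ j, ∃ γ : EuclideanSpace ℝ (Fin 1) → InitialDataSet (𝓡 3) X,
      Tame d 1 γ ∧ fderiv ℝ (Λ j ∘ γ) 0 ≠ 0)
    (hwall : ∀ (m : ℕ) (G : EuclideanSpace ℝ (Fin m) → InitialDataSet (𝓡 3) X), Tame d m G →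
      ∃ δ : ℝ, 0 < δ ∧ ∀ c, ‖c‖ < δ → (∀ j, Λ j (G c) ≠ Λ j d) → Q (G c))
    (hsup : ∀ (m : ℕ) (G : EuclideanSpace ℝ (Fin m) → InitialDataSet (𝓡 3) X)
      (γ : EuclideanSpace ℝ (Fin 1) → InitialDataSet (𝓡 3) X), Tame d m G → Tame d 1 γ →
      ∃ (n : ℕ) (G₁ : EuclideanSpace ℝ (Fin n) → InitialDataSet (𝓡 3) X)
        (L : EuclideanSpace ℝ (Fin m) →ₗ[ℝ] EuclideanSpace ℝ (Fin n))
        (L₁ : EuclideanSpace ℝ (Fin 1) →ₗ[ℝ] EuclideanSpace ℝ (Fin n)),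
        Function.Injective L ∧ Tame d n G₁ ∧ (∀ c, G₁ (L c) = G c) ∧
        ∃ ε : ℝ, 0 < ε ∧ ∀ s, ‖s‖ < ε → G₁ (L₁ s) = γ s) :
    RobustlyEscapable d Q := by
  intro m G hG
  /- Step 1 — TRANSVERSAL ENRICHMENT: by induction on `j ≤ J`, a tame enrichment of `G` along which the first
  `j` walls are transverse at the base point. -/
  have key : ∀ j : ℕ, j ≤ J →
      ∃ (n : ℕ) (G' : EuclideanSpace ℝ (Fin n) → InitialDataSet (𝓡 3) X)
        (L : EuclideanSpace ℝ (Fin m) →ₗ[ℝ] EuclideanSpace ℝ (Fin n)),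
        Function.Injective L ∧ Tame d n G' ∧ (∀ c, G' (L c) = G c) ∧
        ∀ i : Fin J, (i : ℕ) < j → fderiv ℝ (Λ i ∘ G') 0 ≠ 0 := by
    intro j
    induction j with
    | zero =>
      intro _
      exact ⟨m, G, LinearMap.id, fun a b h => h, hG, fun c => rfl, fun i hi => absurd hi (Nat.not_lt_zero _)⟩
    | succ j ih =>
      intro hj
      obtain ⟨n, G', L, hL, hG', hGL, htr⟩ := ih (Nat.le_of_succ_le hj)
      have hjJ : j < J := Nat.lt_of_succ_le hj
      obtain ⟨γ, hγ, hγd⟩ := hcross ⟨j, hjJ⟩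
      obtain ⟨n', G'', L', L₁, hL', hG'', hGL', ε, hε, hax⟩ := hsup n G' γ hG' hγ
      refine ⟨n', G'', L' ∘ₗ L, fun a b h => hL (hL' h), hG'',
        fun c => by rw [LinearMap.comp_apply, hGL', hGL], fun i hi => ?_⟩
      -- `Λ i ∘ G''` is differentiable at the base point (hypothesis (i) on the tame probe `G''`)
      have hd'' : DifferentiableAt ℝ (Λ i ∘ G'') 0 := hdiff n' G'' hG'' i
      rcases (Nat.lt_succ_iff.1 hi).lt_or_eq with hlt | heq
      · -- an OLD wall: `Λ i ∘ G' = (Λ i ∘ G'') ∘ L'`, chain rule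
        intro h0
        apply htr i hlt
        have hcomp : Λ i ∘ G' = (Λ i ∘ G'') ∘ ⇑(LinearMap.toContinuousLinearMap L') := by
          funext c
          simp only [Function.comp_apply, LinearMap.coe_toContinuousLinearMap', hGL']
        have hdL : DifferentiableAt ℝ (Λ i ∘ G'') ((LinearMap.toContinuousLinearMap L') 0) := by
          rw [map_zero]; exact hd''
        rw [hcomp, fderiv_comp (0 : EuclideanSpace ℝ (Fin n)) hdL
          (LinearMap.toContinuousLinearMap L').differentiableAt, ContinuousLinearMap.fderiv, map_zero, h0,
          ContinuousLinearMap.zero_comp]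
      · -- the NEW wall `i = ⟨j, hjJ⟩`: `γ` is a local axis of `G''`
        have hieq : i = ⟨j, hjJ⟩ := Fin.ext heq
        subst hieq
        intro h0
        apply hγd
        have hloc : (Λ ⟨j, hjJ⟩ ∘ γ) =ᶠ[𝓝 0]
            ((Λ ⟨j, hjJ⟩ ∘ G'') ∘ ⇑(LinearMap.toContinuousLinearMap L₁)) := by
          filter_upwards [Metric.ball_mem_nhds (0 : EuclideanSpace ℝ (Fin 1)) hε] with s hs
          rw [Metric.mem_ball, dist_zero_right] at hs
          simp only [Function.comp_apply, LinearMap.coe_toContinuousLinearMap', hax s hs]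
        have hdL : DifferentiableAt ℝ (Λ ⟨j, hjJ⟩ ∘ G'') ((LinearMap.toContinuousLinearMap L₁) 0) := by
          rw [map_zero]; exact hd''
        rw [hloc.fderiv_eq, fderiv_comp (0 : EuclideanSpace ℝ (Fin 1)) hdL
          (LinearMap.toContinuousLinearMap L₁).differentiableAt, ContinuousLinearMap.fderiv, map_zero, h0,
          ContinuousLinearMap.zero_comp]
  obtain ⟨n, G', L, hL, hG', hGL, htr⟩ := key J le_rfl
  refine ⟨n, G', L, hL, hG', hGL, fun p G₂ L' hL' hT₂ hGL₂ => ?_⟩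
  /- Step 2 — GENERAL POSITION in the further enrichment `G₂`. -/
  have hd₂ : ∀ j, DifferentiableAt ℝ (Λ j ∘ G₂) 0 := hdiff p G₂ hT₂
  -- the pulled-back differentials are non-zero functionals (chain rule through `L'`)
  have hℓne : ∀ j, fderiv ℝ (Λ j ∘ G₂) 0 ≠ 0 := by
    intro j h0
    apply htr j j.isLt
    have hcomp : Λ j ∘ G' = (Λ j ∘ G₂) ∘ ⇑(LinearMap.toContinuousLinearMap L') := by
      funext c
      simp only [Function.comp_apply, LinearMap.coe_toContinuousLinearMap', hGL₂]
    have hdL : DifferentiableAt ℝ (Λ j ∘ G₂) ((LinearMap.toContinuousLinearMap L') 0) := by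
      rw [map_zero]; exact hd₂ j
    rw [hcomp, fderiv_comp (0 : EuclideanSpace ℝ (Fin n)) hdL
      (LinearMap.toContinuousLinearMap L').differentiableAt, ContinuousLinearMap.fderiv, map_zero, h0,
      ContinuousLinearMap.zero_comp]
  -- the open dense set of directions transverse to every wall
  have hUo : ∀ j, IsOpen {v : EuclideanSpace ℝ (Fin p) | fderiv ℝ (Λ j ∘ G₂) 0 v ≠ 0} := fun j =>
    isOpen_ne_fun (fderiv ℝ (Λ j ∘ G₂) 0).continuous continuous_const
  have hUd : ∀ j, Dense {v : EuclideanSpace ℝ (Fin p) | fderiv ℝ (Λ j ∘ G₂) 0 v ≠ 0} := by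
    intro j
    obtain ⟨w, hw⟩ := DFunLike.ne_iff.1 (hℓne j)
    exact dense_setOf_apply_ne_zero _ (by simpa using hw)
  refine ⟨⋂ j, {v | fderiv ℝ (Λ j ∘ G₂) 0 v ≠ 0}, isOpen_iInter_of_finite hUo,
    dense_iInter_of_isOpen hUo hUd, fun v hv => ?_⟩
  have hvj : ∀ j, fderiv ℝ (Λ j ∘ G₂) 0 v ≠ 0 := fun j => Set.mem_iInter.1 hv j
  obtain ⟨δ, hδ, hgood⟩ := hwall p G₂ hT₂
  -- along `t ↦ G₂ (t • v)` every wall is left for small `t ≠ 0` (first-order Taylor) …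
  have hev : ∀ᶠ t in 𝓝[≠] (0 : ℝ), ∀ j, Λ j (G₂ (t • v)) ≠ Λ j d := by
    refine Filter.eventually_all.2 fun j => ?_
    have h1 : HasDerivAt (fun s : ℝ => s • v) ((1 : ℝ) • v) 0 := (hasDerivAt_id (0 : ℝ)).smul_const v
    rw [one_smul] at h1
    have h2 : HasFDerivAt (Λ j ∘ G₂) (fderiv ℝ (Λ j ∘ G₂) 0) ((0 : ℝ) • v) := by
      rw [zero_smul]; exact (hd₂ j).hasFDerivAt
    exact (h2.comp_hasDerivAt (0 : ℝ) h1).eventually_ne (hvj j)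
  -- … while the ray stays `δ`-close to the base point
  have hev' : ∀ᶠ t in 𝓝[≠] (0 : ℝ), ‖t • v‖ < δ := by
    have hc : Continuous fun t : ℝ => ‖t • v‖ := (continuous_id.smul continuous_const).norm
    have h0 : ‖(0 : ℝ) • v‖ < δ := by rw [zero_smul, norm_zero]; exact hδ
    exact (hc.continuousAt.eventually_lt continuousAt_const h0).filter_mono nhdsWithin_le_nhds
  have hQ : ∀ᶠ t in 𝓝[≠] (0 : ℝ), Q (G₂ (t • v)) :=
    (hev.and hev').mono fun t ht => hgood _ ht.2 ht.1
  rw [eventually_nhdsWithin_iff, Metric.eventually_nhds_iff] at hQ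
  obtain ⟨δ', hδ', h⟩ := hQ
  exact ⟨δ', hδ', fun t ht htδ => h (by simpa [Real.dist_eq] using htδ) ht⟩

end DataWalls

/-! ## The composition -/

/-- **`CensorshipRobust_of`** — the crux BY NAME from the four registered stubs (used by name): the two pieces from
their stubs (`censorshipWalls_of_stubs`, `tameAxisSuperposition_of_stubs`), then the glue of
`Cruxes/CensorshipRobust/StrategySplit.lean` (`censorshipRobust_of_subs`: unfold the legend and apply
`robustlyEscapable_of_dataWalls` with `Q := Q_B`). -/
theorem CensorshipRobust_of : Theses.RobustClausewiseGenericity.CensorshipRobust := by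
  have hW := censorshipWalls_of_stubs stub_censoredIsProbeOpen stub_nakedThresholdWalls
  have hA := tameAxisSuperposition_of_stubs stub_crossInterpolant stub_crossProjection
  intro X _ _ _ _ _ _ d hd
  have h1 := hW X d hd
  have h2 := hA X d hd
  dsimp only at h1 h2 ⊢
  obtain ⟨J, Λ, hdiff, hcross, hwall⟩ := h1
  exact robustlyEscapable_of_dataWalls (d := d)
    (Q := fun D => ∀ 𝒟 : VacuumCauchyDevelopment D, 𝒟.IsMaximal →
      Summit.FinalStateConjecture.HasCompleteNullInfinity 𝒟.toCauchyDevelopment)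
    Λ hdiff hcross hwall h2

end Summit.FinalStateConjecture.FinalStateConjecture.Cruxes.CensorshipRobust.WallsAndSuperposition

end
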